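import Literature.NumberTheory.GaloisRepresentations.PadicCoefficientsTowerTorsion
import Literature.AnabelianGeometry.AbsoluteAnabelian.AbsTopIThm26iii
import HarnessLib

/-!
# `δ²_l(G) ≥ 1` from a non-torsion class in `H²_cont(G, ℤ_l)` — the `ℤ_l → ℚ_l` junction

S. Mochizuki, *Topics in Absolute Anabelian Geometry I: Generalities* (2012) [AbsTopI], Thm 2.6
p. 21 (`δ²_l(G) := dim_{ℚ_l} H²(G, ℚ_l)`), proof of Thm 2.6 (iii) p. 23 l. 44–47
("`ε²_{l′}(Π) ≥ δ²_{l′}(Π) ≥ 1`"); J. Neukirch, A. Schmidt, K. Wingberg, *Cohomology of Number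
Fields* (2008), (2.7.6) ff. (continuous cochain cohomology with `ℤ_l`- and `ℚ_l`-coefficients of a
profinite group: `H^n_cts(G, ℚ_l) = H^n_cts(G, ℤ_l) ⊗ ℚ`).

PROOF-ONLY file (abc-iut cell, brick «DELTA2-QL-JUNCTION» = (W3) of the «LEM27-HS-LOWDEG» chain;
seat abc-iut-w6-d073).  The converse companion of
`subsingleton_continuousCohomology_two_padic_of_forall_zmod` (`PadicCoefficientsTowerTorsion.lean`):
for a COMPACT topological group `G` and a prime `l`,

* `twoCocycleClass_padic_ne_zero_of_nonTorsion` — a continuous `ℤ_l`-valued `2`-cocycle whose class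
  in `H²_cont(G, ℤ_l)` has infinite additive order has NONZERO class in `H²_cont(G, ℚ_l)` (Mathlib's
  `continuousCohomology` of the trivial representation on `ULift ℚ_l`, the coefficient object of
  [AbsTopI]'s `δ²_l`): if the `ℚ_l`-class were a coboundary `∂b`, `b` is bounded on the compact `G`,
  `l^N b` is `ℤ_l`-valued and `l^N · [c] = [∂(l^N b)] = 0`;
* `one_le_deltaInv_two_of_nonTorsion` — hence `1 ≤ δ²_l(G)` as soon as `H²_cont(G, ℤ_l)` has a class
  of infinite order;
* `one_le_deltaInv_two_of_limitClasses_nonTorsion` — the same from a compatible family of classes in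
  the `H²(G, ℤ/lⁱ)` of infinite order (the tower presentation `padicIntTower`,
  `toLimitClasses_surjective`), the junction shape of the Hochschild–Serre edge files.

HONEST FRAMING: classical continuous cohomology; nothing here bears on [IUTchIII] Cor. 3.12.
-/

noncomputable section

open CategoryTheory Function Topology

namespace Literature.AnabelianGeometry.AbsoluteAnabelian

open Literature.NumberTheory.GaloisRepresentations
open _root_.TopRep _root_.ContRepresentation _root_.ContinuousCohomology

variable {G : Type} [Group G] [TopologicalSpace G] [IsTopologicalGroup G] (l : ℕ) [Fact l.Prime]

/-- **A continuous `ℤ_l`-valued `2`-cocycle with class of infinite order has nonzero class over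
`ℚ_l`** (`G` compact): the coefficient extension `ℤ_l → ℚ_l` of `c` is a `2`-cocycle of the trivial
representation `ℚ_l`; were its class zero, `c = ∂b` over `ℚ_l` with `b` continuous, hence bounded,
`l^N b` is `ℤ_l`-valued and `l^N · [c] = 0` in `H²_cont(G, ℤ_l)`.
[cite: NeukirchSchmidtWingberg2008, Prop (2.7.11)] [cite: MochizukiAbsTopI2012, Thm 2.6 (iii) proof p.23] -/
theorem twoCocycleClass_padic_ne_zero_of_nonTorsion [CompactSpace G]
    (z : contTwoCocycles (padicIntRep G l))
    (hz : ∀ n : ℕ, 0 < n → n • twoCocycleClass (padicIntRep G l) z ≠ 0) :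
    ∃ c : contTwoCocycles (TopRep.of (ContRepresentation.trivial ℚ_[l] G (ULift.{0} ℚ_[l]))),
      (∀ p : G × G, (c.1 p).down = ((z.1 p : ℤ_[l]) : ℚ_[l])) ∧
        twoCocycleClass _ c ≠ 0 := by
  set X : TopRep.{0} ℚ_[l] G := TopRep.of (ContRepresentation.trivial ℚ_[l] G (ULift.{0} ℚ_[l]))
    with hX
  have hl1 : (1 : ℝ) < l := by exact_mod_cast (Fact.out : l.Prime).one_lt
  have hl0 : (0 : ℝ) < l := lt_trans zero_lt_one hl1
  -- the `ℚ_l`-valued cocycle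
  let c₀ : C(G × G, X) :=
    ⟨fun p => ULift.up ((z.1 p : ℤ_[l]) : ℚ_[l]),
      continuous_uliftUp.comp (continuous_subtype_val.comp z.1.continuous)⟩
  have hc₀ : ∀ p : G × G, (c₀ p).down = ((z.1 p : ℤ_[l]) : ℚ_[l]) := fun _ => rfl
  have hcmem : c₀ ∈ contTwoCocycles X := by
    rw [mem_contTwoCocycles_iff]
    intro σ τ υ
    have h := z.2 σ τ υ
    change z.1 (τ, υ) + z.1 (σ, τ * υ) = z.1 (σ * τ, υ) + z.1 (σ, τ) at h
    have h' := congrArg (fun t : ℤ_[l] => (t : ℚ_[l])) h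
    simp only [PadicInt.coe_add] at h'
    apply ULift.ext
    change (c₀ (τ, υ)).down + (c₀ (σ, τ * υ)).down = (c₀ (σ * τ, υ)).down + (c₀ (σ, τ)).down
    rw [hc₀, hc₀, hc₀, hc₀]
    exact h'
  refine ⟨⟨c₀, hcmem⟩, hc₀, fun h0 => ?_⟩
  -- a `ℚ_l`-coboundary: `c₀ = ∂b`, `b` bounded
  obtain ⟨b, hb⟩ := (twoCocycleClass_eq_zero_iff X ⟨c₀, hcmem⟩).1 h0
  have hbcont : Continuous fun g : G => (b g).down := continuous_uliftDown.comp b.continuous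
  obtain ⟨C, hC⟩ := (isCompact_univ (X := G)).bddAbove_image
    (continuous_norm.comp hbcont).continuousOn
  have hC' : ∀ g : G, ‖(b g).down‖ ≤ C := fun g => hC (Set.mem_image_of_mem _ (Set.mem_univ g))
  obtain ⟨N, hN⟩ := pow_unbounded_of_one_lt C hl1
  have hnorm : ∀ g : G, ‖(l : ℚ_[l]) ^ N * (b g).down‖ ≤ 1 := fun g => by
    rw [norm_mul, norm_pow, Padic.norm_p]
    have h1 : ((l : ℝ)⁻¹) ^ N * ‖(b g).down‖ ≤ ((l : ℝ)⁻¹) ^ N * (l : ℝ) ^ N :=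
      mul_le_mul_of_nonneg_left ((hC' g).trans hN.le) (pow_nonneg (inv_nonneg.2 hl0.le) N)
    rw [inv_pow, inv_mul_cancel₀ (pow_ne_zero N hl0.ne')] at h1
    rw [inv_pow]
    exact h1
  -- `l^N b` as a continuous `ℤ_l`-valued cochain
  let b' : C(G, ℤ_[l]) :=
    ⟨fun g => ⟨(l : ℚ_[l]) ^ N * (b g).down, hnorm g⟩, (continuous_const.mul hbcont).subtype_mk _⟩
  have hb' : ∀ g : G, ((b' g : ℤ_[l]) : ℚ_[l]) = (l : ℚ_[l]) ^ N * (b g).down := fun _ => rfl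
  -- `l^N z = ∂b'` over `ℤ_l`
  have hcob : twoCocycleClass (padicIntRep G l) (((l ^ N : ℕ) : ℤ) • z) = 0 := by
    rw [twoCocycleClass_eq_zero_iff]
    refine ⟨b', fun σ τ => ?_⟩
    change (((l ^ N : ℕ) : ℤ) • z.1) (σ, τ) = b' τ - b' (σ * τ) + b' σ
    rw [ContinuousMap.smul_apply, zsmul_eq_mul, Int.cast_natCast]
    apply Subtype.ext  -- injectivity of `ℤ_l → ℚ_l`
    have hστ := congrArg ULift.down (hb σ τ)
    change (c₀ (σ, τ)).down = (b τ).down - (b (σ * τ)).down + (b σ).down at hστ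
    rw [hc₀] at hστ
    change (((((l ^ N : ℕ) : ℤ_[l]) * z.1 (σ, τ) : ℤ_[l])) : ℚ_[l]) =
      (((b' τ - b' (σ * τ) + b' σ : ℤ_[l])) : ℚ_[l])
    push_cast
    rw [hb', hb', hb', hστ]
    ring
  -- contradiction with the infinite order of `[z]`
  have hlN : 0 < l ^ N := pow_pos (Fact.out : l.Prime).pos N
  apply hz (l ^ N) hlN
  rw [← Nat.cast_smul_eq_nsmul ℤ, ← twoCocycleClass_smul]
  exact hcob

/-- **`δ²_l(G) ≥ 1` from a class of infinite order in `H²_cont(G, ℤ_l)`** (`G` compact): the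
`ℚ_l`-vector space `H²_cont(G, ℚ_l)` has a nonzero vector, so positive dimension.
[cite: NeukirchSchmidtWingberg2008, Prop (2.7.11)] [cite: MochizukiAbsTopI2012, Thm 2.6 (iii) proof p.23] -/
theorem one_le_deltaInv_two_of_nonTorsion [CompactSpace G]
    (x : continuousCohomology 2 (padicIntRep G l)) (hx : ∀ n : ℕ, 0 < n → n • x ≠ 0) :
    1 ≤ deltaInv G 2 l := by
  obtain ⟨z, rfl⟩ := twoCocycleClass_surjective (padicIntRep G l) x
  obtain ⟨c, -, hc⟩ := twoCocycleClass_padic_ne_zero_of_nonTorsion l z hx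
  haveI : Nontrivial (continuousCohomology 2
      (TopRep.of (ContRepresentation.trivial ℚ_[l] G (ULift.{0} ℚ_[l])))) :=
    nontrivial_of_ne _ _ hc
  unfold deltaInv
  have h1 : (1 : Cardinal) ≤ Module.rank ℚ_[l] (continuousCohomology 2
      (TopRep.of (ContRepresentation.trivial ℚ_[l] G (ULift.{0} ℚ_[l])))) :=
    Cardinal.one_le_iff_pos.2 rank_pos
  have h2 := OrderHomClass.mono Cardinal.toENat h1
  rwa [map_one] at h2

/-- **`δ²_l(G) ≥ 1` from a compatible family of classes in the `H²(G, ℤ/lⁱ)` of infinite order**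
(`G` compact): every element of `lim_i H²(G, ℤ/lⁱ)` (`padicIntTower.limitClasses`) comes from a class in
`H²_cont(G, ℤ_l)` (`toLimitClasses_surjective`), of infinite order if the family is.  This is the
junction shape consumed by the Hochschild–Serre edge construction of such families.
[cite: NeukirchSchmidtWingberg2008, Cor (2.7.6)] [cite: MochizukiAbsTopI2012, Thm 2.6 (iii) proof p.23] -/
theorem one_le_deltaInv_two_of_limitClasses_nonTorsion [CompactSpace G]
    (c : (padicIntTower G l).limitClasses) (hc : ∀ n : ℕ, 0 < n → n • c ≠ 0) :
    1 ≤ deltaInv G 2 l := by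
  obtain ⟨x, rfl⟩ := (padicIntTower G l).toLimitClasses_surjective c
  refine one_le_deltaInv_two_of_nonTorsion l x fun n hn hx => hc n hn ?_
  rw [← map_nsmul, hx, map_zero]

end Literature.AnabelianGeometry.AbsoluteAnabelian

end
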